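import Literature.Analysis.FluidPDE.TaoCascadeModeDuhamel
import Summits.NavierStokesRegularity.NavierStokesRegularity.Theorems.PerpetualPumpEulerTypeIGlueDuhamel

/-!
# Crux `PerpetualPump.AveragedTypeIBlowup` (stmt-NavierStokesRegularity-1835), line `Sketch`:
# tools for the stub `synthField` — series of band-limited Duhamel terms in `H¹⁰_df`

T. Tao, *Finite time blowup for an averaged three-dimensional Navier–Stokes equation*, J. Amer.
Math. Soc. **29** (2016), 601–674 = arXiv:1402.0290v3, §4 p. 22, (4.14): the mild solution of the
cascade equation is the wavelet Duhamel series
`u(t) = e^{tΔ}u₀ + Σ_{i,n} ∫₀ᵗ G_{i,n}(s) e^{(t-s)Δ} ψ_{i,n} ds`.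

The stub `synthField` of the line's skeleton *constructs* this field from a solution of the
coefficient chain. This file supplies the `L²` bookkeeping for summing the series in `H¹⁰_df(ℝ³)`
over the accepted setting (`L2C`, `IsReal`, `IsFourierDivFree`, `eFourierSobolevNorm`,
`fourierMultiplier`, `IsBandLimited`, `bandProj`, `duhamelV`):

* realness, divergence-freeness and band-limitedness pass to sums of convergent series and to
  interval integrals in `L²` (`isReal_of_hasSum`, `isFourierDivFree_of_hasSum`,
  `stub_synthFieldRealIntegral` — the registered sub-goal this file lands —, `isBandLimited_intervalIntegral`);
* the Bessel-type multiplier `J = (1+|D|²)^{-5}` (symbol `memLp_besselInvFn`), for which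
  `‖J g‖_{H¹⁰} ≤ ‖g‖_{L²}` (`eFourierSobolevNorm_besselInv_le`), and the band weights
  `W_R = (1_R (1+|ξ|²)^5)(D)` (symbol `memLp_bandWeightFn`) with `‖W_R‖ ≤ (1+ρ²)^5` on a band
  `R ⊆ {|ξ| ≤ ρ}` and `J W_R f = f` for `f` band-limited to `R` (`besselInv_bandWeight`): an
  `L²`-convergent series `Σ W_{R_p} f_p` of weighted band-limited terms is sent by `J` to the series
  `Σ f_p`, now with finite `H¹⁰` norm;
* one Duhamel term `∫₀ᵗ q(s) e^{(t-s)Δ}ψ ds` of a wavelet: its pairings, norm, continuity in `t`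
  (through the accepted band Duhamel element `duhamelV`), band-limitedness, divergence-freeness,
  realness.

Nothing here closes the item (`--supports`); no statement of the route changes.

## References

* T. Tao, J. Amer. Math. Soc. 29 (2016), 601–674, arXiv:1402.0290v3, §4 p. 22 (4.14).
  [`Tao2016AveragedNS`]
-/

noncomputable section

-- the summit namespace `…NavierStokesRegularity.NavierStokesRegularity…` is the tree convention
set_option linter.dupNamespace false

open MeasureTheory Set Filter Topology
open scoped ENNReal
open scoped InnerProductSpace ComplexConjugate
open Literature.Analysis
open Literature.Analysis.FluidPDE Literature.Analysis.FluidPDE.Tao2016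
open Literature.Analysis.FluidPDE.TaoCascade (quadTerm IsSymmetricCoeff IsCancellingCoeff)
open Summit.NavierStokesRegularity.NavierStokesRegularity.Theorems.PerpetualPumpEulerTypeIGlue
  (norm_heat_le continuous_heat_apply)

namespace Summit.NavierStokesRegularity.NavierStokesRegularity.Theorems.PerpetualPumpAveragedTypeIBlowup

/-! ### Realness, divergence-freeness, band-limitedness: series and integrals -/

/-- **Realness passes to sums of convergent series in `L²`**: the real fields form the closed
additive subgroup `{u | ū = u}` of `L²(ℝ³; ℂ³)` (`conjL2` is continuous and additive). [folklore] -/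
theorem isReal_of_hasSum {ι : Type*} {f : ι → L2C} {g : L2C} (hf : ∀ i, IsReal (f i))
    (h : HasSum f g) : IsReal g := by
  rw [isReal_iff_conjL2_eq]
  have hcl : IsClosed {u : L2C | conjL2 u = u} := isClosed_eq continuous_conjL2 continuous_id
  refine hcl.mem_of_tendsto h (Eventually.of_forall fun s => ?_)
  refine Finset.sum_induction _ (fun u : L2C => conjL2 u = u) (fun a b ha hb => ?_) ?_ fun i _ => ?_
  · rw [conjL2_add, ha, hb]
  · exact (isReal_iff_conjL2_eq 0).1 isReal_zero
  · exact (isReal_iff_conjL2_eq _).1 (hf i)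

/-- **Divergence-freeness passes to sums of convergent series in `L²`**: the divergence-free fields
form the joint kernel of the bounded functionals `f ↦ ⟪Φ_φ, 𝓕 f⟫`
(`isFourierDivFree_of_forall_inner_divTestVec`), and bounded functionals sum series. [folklore] -/
theorem isFourierDivFree_of_hasSum {ι : Type*} {f : ι → L2C} {g : L2C}
    (hf : ∀ i, IsFourierDivFree (f i)) (h : HasSum f g) : IsFourierDivFree g := by
  refine isFourierDivFree_of_forall_inner_divTestVec fun φ hφ => ?_
  set T : L2C →L[ℂ] ℂ := (innerSL ℂ ((memLp_divTestVec hφ).toLp _ : L2C)).comp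
    (Lp.fourierTransformₗᵢ (EuclideanSpace ℝ (Fin 3)) (EuclideanSpace ℂ (Fin 3))).toLinearIsometry.toContinuousLinearMap
    with hT
  have h1 : HasSum (fun i => T (f i)) (T g) := h.mapL T
  have h2 : (fun i => T (f i)) = fun _ => 0 := by
    funext i
    exact (hf i).inner_divTestVec_eq_zero hφ
  rw [h2] at h1
  exact h1.unique hasSum_zero

/-- **Bounded functionals sum series**: `⟨Σ fᵢ, w⟩ = Σ ⟨fᵢ, w⟩` for an `L²`-convergent series
(`⟨·, w⟩ = ⟪w̄, ·⟫` is a bounded functional). [folklore] -/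
theorem hasSum_pairing_left {ι : Type*} {f : ι → L2C} {g : L2C} (h : HasSum f g) (w : L2C) :
    HasSum (fun i => pairing (f i) w) (pairing g w) := by
  have h1 := h.mapL (innerSL ℂ (conjL2 w))
  simp only [innerSL_apply_apply] at h1
  simpa only [pairing_eq_inner_conjL2] using h1

/-- `⟪w, f̄⟫ = \overline{⟪w̄, f⟫}` on `L²(ℝ³; ℂ³)`. [folklore] -/
theorem inner_conjL2_right (w f : L2C) : ⟪w, conjL2 f⟫_ℂ = conj ⟪conjL2 w, f⟫_ℂ := by
  rw [MeasureTheory.L2.inner_def, MeasureTheory.L2.inner_def, ← integral_conj]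
  refine integral_congr_ae ?_
  filter_upwards [coeFn_conjL2 f, coeFn_conjL2 w] with x h1 h2
  rw [h1, h2]
  simp only [PiLp.inner_apply, RCLike.inner_apply, conj3_apply, map_sum, map_mul,
    Complex.conj_conj]

/-- **Realness is preserved by interval (Bochner) integrals in `L²`** (registered sub-goal
`stub_synthFieldRealIntegral` of the stub `synthField`): test `ū = u` against every `w`, and move
the bounded functionals `⟪w, ·⟫`, `⟪w̄, ·⟫` inside the integral. [folklore] -/
theorem stub_synthFieldRealIntegral :
    ∀ {F : ℝ → L2C} {a b : ℝ}, IntervalIntegrable F volume a b → (∀ s, IsReal (F s)) →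
      IsReal (∫ s in a..b, F s) := by
  intro F a b hF h
  rw [isReal_iff_conjL2_eq]
  refine ext_inner_left ℂ fun w => ?_
  have hcomm : ∀ v : L2C, ⟪v, ∫ s in a..b, F s⟫_ℂ = ∫ s in a..b, ⟪v, F s⟫_ℂ := fun v => by
    rw [← innerSL_apply_apply ℂ, ← (innerSL ℂ v).intervalIntegral_comp_comm hF]
    rfl
  have hpt : ∀ s, conj ⟪conjL2 w, F s⟫_ℂ = ⟪w, F s⟫_ℂ := fun s => by
    rw [← inner_conjL2_right, (isReal_iff_conjL2_eq _).1 (h s)]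
  rw [inner_conjL2_right, hcomm, hcomm]
  simp only [intervalIntegral, map_sub, ← integral_conj, hpt]

/-- **Band-limitedness is preserved by interval (Bochner) integrals in `L²`** (the band-limited
fields are the fixed points of the bounded projection `1_R(D)`). [folklore] -/
theorem isBandLimited_intervalIntegral {R : Set (EuclideanSpace ℝ (Fin 3))} (hR : MeasurableSet R)
    {F : ℝ → L2C} {a b : ℝ} (hF : IntervalIntegrable F volume a b) (h : ∀ s, IsBandLimited R (F s)) :
    IsBandLimited R (∫ s in a..b, F s) := by
  have h1 : bandProj hR (∫ s in a..b, F s) = ∫ s in a..b, F s := by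
    rw [← (bandProj hR).intervalIntegral_comp_comm hF]
    exact intervalIntegral.integral_congr fun s _ => (h s).bandProj_eq hR
  rw [← h1]
  exact isBandLimited_bandProj hR _

/-! ### The multiplier `J = (1+|D|²)^{-5}` and the band weights `W_R = (1_R (1+|ξ|²)^5)(D)` -/

/-- The symbol `(1+|ξ|²)^{-5}` of `J = (1+|D|²)^{-5}` (which maps `L²` into `H¹⁰` for the Fourier
weight `(1+|ξ|²)^{10}` of the accepted `eFourierSobolevNorm 10`) is an `L^∞` symbol, bounded by `1`. [folklore] -/
theorem memLp_besselInvFn :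
    MemLp (fun ξ : EuclideanSpace ℝ (Fin 3) => ((((1 + ‖ξ‖ ^ 2) ^ 5)⁻¹ : ℝ) : ℂ)) ∞ volume := by
  refine memLp_top_of_bound ?_ 1 (Eventually.of_forall fun ξ => ?_)
  · refine (Complex.continuous_ofReal.comp (Continuous.inv₀ (by fun_prop) fun ξ => ?_)).aestronglyMeasurable
    positivity
  · rw [Complex.norm_real, Real.norm_eq_abs, abs_of_pos (by positivity)]
    exact inv_le_one_of_one_le₀ (one_le_pow₀ (by nlinarith [sq_nonneg ‖ξ‖]))

/-- **`‖J g‖_{H¹⁰} ≤ ‖g‖_{L²}` for `J = (1+|D|²)^{-5}`** (in fact equality: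
`(1+|ξ|²)^{10} |(1+|ξ|²)^{-5} ĝ|² = |ĝ|²` and Plancherel). [folklore] -/
theorem eFourierSobolevNorm_besselInv_le (g : L2C) :
    FunctionSpaces.eFourierSobolevNorm 10 (fourierMultiplier (memLp_besselInvFn.toLp _) g) ≤ ‖g‖ₑ := by
  rw [← FunctionSpaces.eFourierSobolevNorm_zero_eq_enorm]
  unfold FunctionSpaces.eFourierSobolevNorm
  refine ENNReal.rpow_le_rpow (lintegral_mono_ae ?_) (by norm_num)
  filter_upwards [fourierFn_fourierMultiplier_toLp memLp_besselInvFn g] with ξ hξ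
  change ENNReal.ofReal ((1 + ‖ξ‖ ^ 2) ^ (10 : ℝ)) *
      ‖fourierFn (fourierMultiplier (memLp_besselInvFn.toLp _) g) ξ‖ₑ ^ 2 ≤
    ENNReal.ofReal ((1 + ‖ξ‖ ^ 2) ^ (0 : ℝ)) * ‖fourierFn g ξ‖ₑ ^ 2
  rw [hξ, enorm_smul, mul_pow, ← mul_assoc, Real.rpow_zero, ENNReal.ofReal_one, one_mul]
  refine mul_le_of_le_one_left zero_le (le_of_eq ?_)
  rw [← ofReal_norm, ← ENNReal.ofReal_pow (norm_nonneg _), ← ENNReal.ofReal_mul (by positivity),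
    ← ENNReal.ofReal_one]
  congr 1
  rw [Complex.norm_real, Real.norm_eq_abs, abs_of_pos (by positivity)]
  have h10 : (1 + ‖ξ‖ ^ 2) ^ (10 : ℝ) = ((1 + ‖ξ‖ ^ 2) ^ 5) ^ 2 := by
    rw [← pow_mul, show (10 : ℝ) = ((10 : ℕ) : ℝ) by norm_num, Real.rpow_natCast]
  rw [h10, inv_pow, mul_inv_cancel₀ (by positivity)]

section Band

variable {R : Set (EuclideanSpace ℝ (Fin 3))} (hR : MeasurableSet R) {ρ : ℝ}
  (hρ : R ⊆ Metric.closedBall 0 ρ)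

include hρ in
/-- On a band inside `{|ξ| ≤ ρ}` the weight symbol `1_R(ξ) (1+|ξ|²)^5` is bounded by `(1+ρ²)^5`. [folklore] -/
theorem norm_bandWeightFn_le (ξ : EuclideanSpace ℝ (Fin 3)) :
    ‖R.indicator (fun η : EuclideanSpace ℝ (Fin 3) => ((((1 + ‖η‖ ^ 2) ^ 5 : ℝ)) : ℂ)) ξ‖ ≤
      (1 + ρ ^ 2) ^ 5 := by
  by_cases hξ : ξ ∈ R
  · rw [indicator_of_mem hξ, Complex.norm_real, Real.norm_eq_abs, abs_of_pos (by positivity)]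
    have hn : ‖ξ‖ ≤ ρ := by simpa using hρ hξ
    have h2 : ‖ξ‖ ^ 2 ≤ ρ ^ 2 := pow_le_pow_left₀ (norm_nonneg _) hn 2
    exact pow_le_pow_left₀ (by positivity) (by linarith) 5
  · rw [indicator_of_notMem hξ, norm_zero]
    positivity

include hR hρ in
/-- The weight symbol `1_R(ξ) (1+|ξ|²)^5` of `W_R` (inverting `J` on the band `R`) is an `L^∞`
symbol. [folklore] -/
theorem memLp_bandWeightFn :
    MemLp (R.indicator fun η : EuclideanSpace ℝ (Fin 3) => ((((1 + ‖η‖ ^ 2) ^ 5 : ℝ)) : ℂ)) ∞ volume := by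
  refine memLp_top_of_bound ?_ ((1 + ρ ^ 2) ^ 5) (Eventually.of_forall (norm_bandWeightFn_le hρ))
  refine AEStronglyMeasurable.indicator ?_ hR
  exact (Complex.continuous_ofReal.comp (by fun_prop)).aestronglyMeasurable

/-- `‖W_R f‖ ≤ (1+ρ²)^5 ‖f‖`. [folklore] -/
theorem norm_bandWeight_le (f : L2C) :
    ‖fourierMultiplier ((memLp_bandWeightFn hR hρ).toLp _) f‖ ≤ (1 + ρ ^ 2) ^ 5 * ‖f‖ := by
  refine norm_fourierMultiplier_le_of_bound _ ?_ f
  filter_upwards [MemLp.coeFn_toLp (memLp_bandWeightFn hR hρ)] with ξ h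
  rw [h]
  exact norm_bandWeightFn_le hρ ξ

/-- **`J W_R f = f` for `f` band-limited to `R`** (`(1+|ξ|²)^{-5} · 1_R (1+|ξ|²)^5 = 1_R`, and
`1_R(D)` fixes band-limited fields). [folklore] -/
theorem besselInv_bandWeight {f : L2C} (hf : IsBandLimited R f) :
    fourierMultiplier (memLp_besselInvFn.toLp _) (fourierMultiplier ((memLp_bandWeightFn hR hρ).toLp _) f) = f := by
  rw [fourierMultiplier_fourierMultiplier _ _ ((memLp_top_indicator_one hR).toLp _) ?_ f]
  · refine hf.fourierMultiplier_eq_self _ ?_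
    filter_upwards [MemLp.coeFn_toLp (memLp_top_indicator_one hR)] with ξ h hξ
    rw [h]
    exact indicator_of_mem hξ _
  · filter_upwards [MemLp.coeFn_toLp (memLp_top_indicator_one hR), MemLp.coeFn_toLp memLp_besselInvFn,
      MemLp.coeFn_toLp (memLp_bandWeightFn hR hρ)] with ξ h1 h2 h3
    rw [h1, h2, h3]
    by_cases hξ : ξ ∈ R
    · rw [indicator_of_mem hξ, indicator_of_mem hξ, ← Complex.ofReal_mul,
        inv_mul_cancel₀ (by positivity), Complex.ofReal_one]
    · rw [indicator_of_notMem hξ, indicator_of_notMem hξ, mul_zero]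

/-- `W_R f` is band-limited to `R`. [folklore] -/
theorem isBandLimited_bandWeight (f : L2C) :
    IsBandLimited R (fourierMultiplier ((memLp_bandWeightFn hR hρ).toLp _) f) := by
  refine IsBandLimited.of_symbol _ ?_ f
  filter_upwards [MemLp.coeFn_toLp (memLp_bandWeightFn hR hρ)] with ξ h1 hξ
  rw [h1]
  exact indicator_of_notMem hξ _

end Band

/-- **Summing weighted band-limited terms**: if `Σ_p W_{R_p} f_p` converges in `L²` to `G`, each
`f_p` band-limited to `R_p`, then `Σ_p f_p` converges to `J G` (apply the bounded `J` termwise,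
`J W_{R_p} f_p = f_p`). [folklore] -/
theorem hasSum_of_hasSum_bandWeight {ι : Type*} {R : ι → Set (EuclideanSpace ℝ (Fin 3))}
    (hR : ∀ p, MeasurableSet (R p)) {ρ : ι → ℝ} (hρ : ∀ p, R p ⊆ Metric.closedBall 0 (ρ p))
    {f : ι → L2C} (hf : ∀ p, IsBandLimited (R p) (f p)) {G : L2C}
    (h : HasSum (fun p => fourierMultiplier ((memLp_bandWeightFn (hR p) (hρ p)).toLp _) (f p)) G) :
    HasSum f (fourierMultiplier (memLp_besselInvFn.toLp _) G) := by
  have h1 := h.mapL (fourierMultiplierCLM (memLp_besselInvFn.toLp _))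
  have h2 : (fun p => fourierMultiplierCLM (memLp_besselInvFn.toLp _)
      (fourierMultiplier ((memLp_bandWeightFn (hR p) (hρ p)).toLp _) (f p))) = f :=
    funext fun p => besselInv_bandWeight (hR p) (hρ p) (hf p)
  rwa [h2] at h1

/-- **`H¹⁰` distances of `a + J g`**: `‖(a + Jg) - (a₀ + Jg₀)‖_{H¹⁰} ≤ ‖a - a₀‖_{H¹⁰} + ‖g - g₀‖_{L²}`. [folklore] -/
theorem eFourierSobolevNorm_add_besselInv_sub_le (a a₀ g g₀ : L2C) :
    FunctionSpaces.eFourierSobolevNorm 10 ((a + fourierMultiplier (memLp_besselInvFn.toLp _) g) -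
        (a₀ + fourierMultiplier (memLp_besselInvFn.toLp _) g₀)) ≤
      FunctionSpaces.eFourierSobolevNorm 10 (a - a₀) + ‖g - g₀‖ₑ := by
  have h : (a + fourierMultiplier (memLp_besselInvFn.toLp _) g) -
      (a₀ + fourierMultiplier (memLp_besselInvFn.toLp _) g₀) =
      (a - a₀) + (fourierMultiplier (memLp_besselInvFn.toLp _) g -
        fourierMultiplier (memLp_besselInvFn.toLp _) g₀) := by
    abel
  rw [h, ← fourierMultiplier_sub]
  refine (eFourierSobolevNorm_add_le 10 _ _).trans ?_
  gcongr
  exact eFourierSobolevNorm_besselInv_le (g - g₀)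

/-! ### One Duhamel term `∫₀ᵗ q(s) e^{(t-s)Δ} ψ ds` -/

/-- **Pairings of a Duhamel term**: `⟨∫ₐᵇ q(s) F(s) ds, w⟩ = ∫ₐᵇ q(s) ⟨F(s), w⟩ ds` (the bounded
functional `⟨·, w⟩ = ⟪w̄, ·⟫` commutes with the Bochner integral). [folklore] -/
theorem pairing_intervalIntegral_smul {F : ℝ → L2C} {q : ℝ → ℂ} {a b : ℝ}
    (hF : IntervalIntegrable (fun s => q s • F s) volume a b) (w : L2C) :
    pairing (∫ s in a..b, q s • F s) w = ∫ s in a..b, q s * pairing (F s) w := by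
  simp_rw [pairing_eq_inner_conjL2]
  rw [← innerSL_apply_apply ℂ, ← (innerSL ℂ (conjL2 w)).intervalIntegral_comp_comm hF]
  simp only [innerSL_apply_apply, inner_smul_right]

/-- `‖∫₀ᵗ q(s) e^{(t-s)Δ}ψ ds‖ ≤ Q t ‖ψ‖` if `|q| ≤ Q` on `[0,t]` (`e^{τΔ}` contracts `L²`). [folklore] -/
theorem norm_intervalIntegral_smul_heat_le {q : ℝ → ℂ} {t Q : ℝ} (ht : 0 ≤ t)
    (hq : ∀ s ∈ Icc 0 t, ‖q s‖ ≤ Q) (ψ : L2C) :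
    ‖∫ s in (0 : ℝ)..t, q s • heat (t - s) ψ‖ ≤ Q * t * ‖ψ‖ := by
  have h := intervalIntegral.norm_integral_le_of_norm_le_const (a := 0) (b := t) (C := Q * ‖ψ‖)
    (f := fun s => q s • heat (t - s) ψ) fun s hs => by
      rw [uIoc_of_le ht] at hs
      rw [norm_smul]
      exact mul_le_mul (hq s (Ioc_subset_Icc_self hs)) (norm_heat_le _ _) (norm_nonneg _)
        ((norm_nonneg _).trans (hq s (Ioc_subset_Icc_self hs)))
  rw [sub_zero, abs_of_nonneg ht] at h
  calc ‖∫ s in (0 : ℝ)..t, q s • heat (t - s) ψ‖ ≤ Q * ‖ψ‖ * t := h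
    _ = Q * t * ‖ψ‖ := by ring

/-- The Duhamel integrand `s ↦ q(s) e^{(t-s)Δ} ψ` is interval integrable on `[0,t]` when `q` is
continuous there (the heat propagator is strongly continuous, `continuous_heat_apply`). [folklore] -/
theorem intervalIntegrable_smul_heat {q : ℝ → ℂ} {t : ℝ} (ht : 0 ≤ t) (hq : ContinuousOn q (Icc 0 t))
    (ψ : L2C) : IntervalIntegrable (fun s => q s • heat (t - s) ψ) volume 0 t := by
  refine ContinuousOn.intervalIntegrable ?_
  rw [uIcc_of_le ht]
  exact hq.smul ((continuous_heat_apply ψ).comp (continuous_const.sub continuous_id)).continuousOn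

/-- A Duhamel term of a divergence-free `ψ` is divergence free. [folklore] -/
theorem isFourierDivFree_intervalIntegral_smul_heat {ψ : L2C} (hψ : IsFourierDivFree ψ) {q : ℝ → ℂ}
    {t : ℝ} (hF : IntervalIntegrable (fun s => q s • heat (t - s) ψ) volume 0 t) :
    IsFourierDivFree (∫ s in (0 : ℝ)..t, q s • heat (t - s) ψ) :=
  isFourierDivFree_intervalIntegral hF fun _ _ => (hψ.heat _).smul _

/-- A Duhamel term of a real `ψ` with real drive is real. [folklore] -/
theorem isReal_intervalIntegral_smul_heat {ψ : L2C} (hψ : IsReal ψ) {q : ℝ → ℝ} {t : ℝ}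
    (hF : IntervalIntegrable (fun s => ((q s : ℝ) : ℂ) • heat (t - s) ψ) volume 0 t) :
    IsReal (∫ s in (0 : ℝ)..t, ((q s : ℝ) : ℂ) • heat (t - s) ψ) :=
  stub_synthFieldRealIntegral hF fun _ => (hψ.heat _).smul _

section Term

variable {ε₀ : ℝ} {m : ℕ} (hε : 0 < 1 + ε₀) (𝒟 : CascadeWaveletData ε₀ m) (i : Fin m) (n : ℤ)
  {ψ : L2C} (hψ : IsBandLimited (freqRegion 𝒟 i n) ψ)

include hψ in
/-- A Duhamel term of a `ψ` band-limited to the region of a mode is band-limited to it. [folklore] -/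
theorem isBandLimited_intervalIntegral_smul_heat {q : ℝ → ℂ} {t : ℝ}
    (hF : IntervalIntegrable (fun s => q s • heat (t - s) ψ) volume 0 t) :
    IsBandLimited (freqRegion 𝒟 i n) (∫ s in (0 : ℝ)..t, q s • heat (t - s) ψ) :=
  isBandLimited_intervalIntegral (measurableSet_freqRegion 𝒟 i n) hF
    fun _ => (heat_isBandLimited hψ _).smul _

include hε hψ in
/-- **A Duhamel term is a band Duhamel element**: for `ψ` band-limited to the region of `(i,n)`,
`t ∈ [0,S']` and a continuous `g` agreeing with `q` on `[0,S']`,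
`∫₀ᵗ q(s) e^{(t-s)Δ}ψ ds = V(t)` with `V = duhamelV … g 0 ψ` (accepted `duhamelV_eq`; on `[0,t]` the
band heat flow is the heat flow). [cite: Tao2016AveragedNS, §4 p. 22 (4.14)] -/
theorem intervalIntegral_smul_heat_eq_duhamelV {q g : ℝ → ℂ} (hg : Continuous g) {S' t : ℝ}
    (ht : t ∈ Icc 0 S') (hgq : ∀ s ∈ Icc 0 S', g s = q s) :
    ∫ s in (0 : ℝ)..t, q s • heat (t - s) ψ =
      duhamelV (measurableSet_freqRegion 𝒟 i n) (freqRegion_subset_closedBall hε 𝒟 i n) g 0 ψ t := by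
  rw [duhamelV_eq _ _ hg, map_zero, zero_add]
  refine intervalIntegral.integral_congr fun s hs => ?_
  rw [uIcc_of_le ht.1] at hs
  rw [hgq s ⟨hs.1, hs.2.trans ht.2⟩, bandHeat_freqRegion_eq_heat hε i n (sub_nonneg.2 hs.2) hψ]

include hε hψ in
/-- Hence `t ↦ ∫₀ᵗ q(s) e^{(t-s)Δ}ψ ds` is `L²`-continuous on `[0,S']` whenever `q` has a continuous
extension from `[0,S']` (accepted `continuous_duhamelV`). [folklore] -/
theorem continuousOn_intervalIntegral_smul_heat {q g : ℝ → ℂ} (hg : Continuous g) {S' : ℝ}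
    (hgq : ∀ s ∈ Icc 0 S', g s = q s) :
    ContinuousOn (fun t => ∫ s in (0 : ℝ)..t, q s • heat (t - s) ψ) (Icc 0 S') :=
  (continuous_duhamelV _ _ hg 0 ψ).continuousOn.congr fun _ ht =>
    intervalIntegral_smul_heat_eq_duhamelV hε 𝒟 i n hψ hg ht hgq

end Term

end Summit.NavierStokesRegularity.NavierStokesRegularity.Theorems.PerpetualPumpAveragedTypeIBlowup

end
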